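import Summits.RiemannHypothesis.RiemannHypothesis.Theorems.Splittings.LiIncrBlockLawOfRH
import Summits.RiemannHypothesis.RiemannHypothesis.Theorems.Splittings.LiSignPatterns
import HarnessLib

/-!
# rh-split (li, bridge) — Part Z STAGED AGAINST THE TREE: the ZERO–POSITIVE LAW for the descent set

This file is `HOME/rh-split-li-bridge/SketchG6Z.lean` (sha16 ca879c81ab99fa7a, referee REPLAY PASS
2026-08-27T07:51:13Z) lines 2291–2433 = namespace `RhSplit.LiBridgeG6Z` (Part Z) VERBATIM, with exactly
three mechanical changes (lead instruction 2026-08-27T07:49:36Z «stage it as ONE file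
LiDescentZeroPositiveLaw importing (f)»): (i) the namespace is the tree-style
`Summit.RiemannHypothesis.RiemannHypothesis.Theorems.Splittings.LiDescentZeroPositiveLaw`; (ii) the one
reference to the scratch theorem `RhSplit.LiBridgeG6T.rh_iff_almostAllLiMonotone_root` is re-pointed at the
TREE's lane-(xi)(f) module `Splittings.LiIncrBlockLawOfRH.rh_iff_almostAllLiMonotone_root` (same statement,
typer-2 g4 ten-file carve, referee BYTES PASS 08:01:28Z); (iii) imports = that module + `LiSignPatterns`
(tree T-Li2 / thick-set vocabulary: `liIncr_two_signs_of_not_rh`, `rh_of_liIncr_nonneg_on_thick`,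
`isThick_of_densityZero`) + `HarnessLib`.  Five theorems, NO `def`, no sorry / native_decide / axiom /
instance / set_option.  Filing (if any) is the typer's; class words are the referee's.  Nothing here bears
on the truth of RH: `rh_iff_liDescent_densityZero` and `not_rh_iff_liDescent_syndetic` are RH-EQUIVALENCES
(relabelling of RH in the descent-set language), `liDescent_zero_positive_law` is their excluded-middle
disjunction.
-/

noncomputable section

/-! # Part Z — the ZERO–POSITIVE LAW for the DESCENT SET `D = {n : λ_{n+1} < λ_n}` of the
Keiper–Li sequence: `D` has natural density zero (⟺ RH, tree `LiIncrBlockLawOfRH.rh_iff_almostAllLiMonotone_root` (lane (xi)(f)) + tree T-Li2) or `D` is eventually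
SYNDETIC — a descent in every window of a fixed length, hence `#(D ∩ [0,N)) ≫ N` (⟺ ¬RH, tree
`liIncr_two_signs_of_not_rh`); never both. Nothing here bears on the truth of RH. -/

namespace Summit.RiemannHypothesis.RiemannHypothesis.Theorems.Splittings.LiDescentZeroPositiveLaw

open Filter Finset
open Literature.NumberTheory.LFunctions
open Summit.RiemannHypothesis.RiemannHypothesis.Theorems.Splittings.LiExtremalLayer
  (liIncr_two_signs_of_not_rh rh_of_liIncr_nonneg_on_thick isThick_of_densityZero)

open Classical in
/-- **RH ⟺ the descent set `{n : λ_{n+1} < λ_n}` has natural density zero.** (`→`: Part T gives a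
density-zero `E` off which `λ` is non-decreasing for `n ≥ 1`, so `D ⊆ E ∪ {0}`; `←`: the complement of a
density-zero set is thick (tree `isThick_of_densityZero`) and `λ` non-decreasing on a thick set ⟹ RH
(tree `rh_of_liIncr_nonneg_on_thick`).) -/
theorem rh_iff_liDescent_densityZero :
    RiemannHypothesis ↔ ∀ ε : ℝ, 0 < ε → ∀ᶠ N : ℕ in atTop,
      (((range N).filter
          (fun n => n ∈ {n : ℕ | keiperLiCoeff (n + 1) < keiperLiCoeff n})).card : ℝ) ≤ ε * N := by
  constructor
  · intro hRH ε hε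
    obtain ⟨E, hE, hmono⟩ := Summit.RiemannHypothesis.RiemannHypothesis.Theorems.Splittings.LiIncrBlockLawOfRH.rh_iff_almostAllLiMonotone_root.1 hRH
    have h1 : ∀ᶠ N : ℕ in atTop, (1 : ℝ) ≤ ε / 2 * N := by
      filter_upwards [(tendsto_natCast_atTop_atTop (R := ℝ)).eventually_ge_atTop (2 / ε)]
        with N hN
      have h' : 2 / ε * (ε / 2) = 1 := by field_simp
      have := mul_le_mul_of_nonneg_right hN (by positivity : (0 : ℝ) ≤ ε / 2)
      linarith
    filter_upwards [hE (ε / 2) (half_pos hε), h1] with N hN hN1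
    have hsub : (range N).filter
          (fun n => n ∈ {n : ℕ | keiperLiCoeff (n + 1) < keiperLiCoeff n}) ⊆
        insert 0 ((range N).filter (fun n => n ∈ E)) := by
      intro n hn
      rw [mem_filter, Set.mem_setOf_eq] at hn
      rw [mem_insert, mem_filter]
      by_cases h0 : n = 0
      · exact Or.inl h0
      · refine Or.inr ⟨hn.1, ?_⟩
        by_contra hnE
        have := hmono n (Nat.one_le_iff_ne_zero.2 h0) hnE
        linarith [hn.2]
    have hcard : (((range N).filter
          (fun n => n ∈ {n : ℕ | keiperLiCoeff (n + 1) < keiperLiCoeff n})).card : ℝ) ≤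
        ((range N).filter (fun n => n ∈ E)).card + 1 := by
      exact_mod_cast (card_le_card hsub).trans (card_insert_le _ _)
    simp only [Set.mem_setOf_eq] at hcard ⊢
    linarith
  · intro hD
    exact rh_of_liIncr_nonneg_on_thick (isThick_of_densityZero hD) fun n hn ↦ by
      have h2 := hn.2
      simp only [Set.mem_setOf_eq, not_lt] at h2
      exact h2

open Classical in
/-- **¬RH ⟺ the descent set is eventually SYNDETIC**: there are `L, n₁` with a descent
`λ_{n+1} < λ_n` in every window `[a, a+L)`, `a ≥ n₁`. (`→`: tree `liIncr_two_signs_of_not_rh`, the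
extremal-layer law; `←`: under RH the complement of the descent set is thick, and a thick set contains a
whole window `[a + n₁, a + n₁ + L)`.) -/
theorem not_rh_iff_liDescent_syndetic :
    ¬ RiemannHypothesis ↔ ∃ L n₁ : ℕ, ∀ a : ℕ, n₁ ≤ a →
      ∃ n ∈ Ico a (a + L), keiperLiCoeff (n + 1) < keiperLiCoeff n := by
  constructor
  · intro hRH
    obtain ⟨L, n₁, h⟩ := liIncr_two_signs_of_not_rh hRH
    exact ⟨L, n₁, fun a ha ↦ (h a ha).1⟩
  · rintro ⟨L, n₁, hsyn⟩ hRH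
    have hT := isThick_of_densityZero (rh_iff_liDescent_densityZero.1 hRH)
    obtain ⟨a, ha⟩ := hT (L + n₁)
    obtain ⟨n, hn, hlt⟩ := hsyn (a + n₁) (by omega)
    rw [mem_Ico] at hn
    obtain ⟨t, rfl⟩ := Nat.exists_eq_add_of_le (show a ≤ n by omega)
    exact (ha t (by omega)).2 hlt

open Classical in
/-- Counting form of the syndetic alternative: `k` disjoint windows past `n₁` carry `k` descents, so
`#{n < n₁ + kL : λ_{n+1} < λ_n} ≥ k` — positive lower density `≥ 1/L` (up to the offset `n₁`). -/
theorem card_liDescent_ge_of_syndetic {L n₁ : ℕ}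
    (hsyn : ∀ a : ℕ, n₁ ≤ a → ∃ n ∈ Ico a (a + L), keiperLiCoeff (n + 1) < keiperLiCoeff n)
    (k : ℕ) :
    k ≤ ((range (n₁ + k * L)).filter
      (fun n => n ∈ {n : ℕ | keiperLiCoeff (n + 1) < keiperLiCoeff n})).card := by
  induction k with
  | zero => exact Nat.zero_le _
  | succ k ih =>
    obtain ⟨n, hn, hlt⟩ := hsyn (n₁ + k * L) (by omega)
    rw [mem_Ico] at hn
    have hnot : n ∉ (range (n₁ + k * L)).filter
        (fun n => n ∈ {n : ℕ | keiperLiCoeff (n + 1) < keiperLiCoeff n}) := by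
      rw [mem_filter, mem_range]; omega
    have hsub : insert n ((range (n₁ + k * L)).filter
          (fun n => n ∈ {n : ℕ | keiperLiCoeff (n + 1) < keiperLiCoeff n})) ⊆
        (range (n₁ + (k + 1) * L)).filter
          (fun n => n ∈ {n : ℕ | keiperLiCoeff (n + 1) < keiperLiCoeff n}) := by
      intro x hx
      rw [mem_insert] at hx
      rw [mem_filter, mem_range, Set.mem_setOf_eq, add_one_mul]
      rcases hx with rfl | hx
      · exact ⟨by omega, hlt⟩
      · rw [mem_filter, mem_range, Set.mem_setOf_eq] at hx
        exact ⟨by omega, hx.2⟩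
    have := card_le_card hsub
    rw [card_insert_of_notMem hnot] at this
    omega

open Classical in
/-- **¬RH ⟹ the descent set has positive lower density** (explicit: `#{n < N : λ_{n+1} < λ_n} ≥
(N − n₁)/L − 1` along `N = n₁ + kL`; stated as `∃ L ≥ 1, ∃ n₁, ∀ k, k ≤ #{n < n₁ + kL : …}`). -/
theorem liDescent_lower_density_of_not_rh (hRH : ¬ RiemannHypothesis) :
    ∃ L n₁ : ℕ, 1 ≤ L ∧ ∀ k : ℕ, k ≤ ((range (n₁ + k * L)).filter
      (fun n => n ∈ {n : ℕ | keiperLiCoeff (n + 1) < keiperLiCoeff n})).card := by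
  obtain ⟨L, n₁, hsyn⟩ := not_rh_iff_liDescent_syndetic.1 hRH
  have hL : 1 ≤ L := by
    obtain ⟨n, hn, -⟩ := hsyn n₁ le_rfl
    rw [mem_Ico] at hn
    omega
  exact ⟨L, n₁, hL, card_liDescent_ge_of_syndetic hsyn⟩

open Classical in
/-- **THE ZERO–POSITIVE LAW for the descent set of `λ_n`.** Exactly one of: (i) `{n : λ_{n+1} < λ_n}`
has natural density zero [this is RH]; (ii) it is eventually syndetic — a descent in every window of a
fixed length `L` past `n₁`, so its counting function is `≥ (N − n₁)/L − 1` [this is ¬RH]. An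
unconditional kernel theorem; which alternative holds is the Riemann Hypothesis, on which nothing here
bears. -/
theorem liDescent_zero_positive_law :
    ((∀ ε : ℝ, 0 < ε → ∀ᶠ N : ℕ in atTop,
        (((range N).filter
          (fun n => n ∈ {n : ℕ | keiperLiCoeff (n + 1) < keiperLiCoeff n})).card : ℝ) ≤ ε * N) ∧
      ¬ ∃ L n₁ : ℕ, ∀ a : ℕ, n₁ ≤ a →
        ∃ n ∈ Ico a (a + L), keiperLiCoeff (n + 1) < keiperLiCoeff n) ∨
    ((∃ L n₁ : ℕ, ∀ a : ℕ, n₁ ≤ a →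
        ∃ n ∈ Ico a (a + L), keiperLiCoeff (n + 1) < keiperLiCoeff n) ∧
      ¬ ∀ ε : ℝ, 0 < ε → ∀ᶠ N : ℕ in atTop,
        (((range N).filter
          (fun n => n ∈ {n : ℕ | keiperLiCoeff (n + 1) < keiperLiCoeff n})).card : ℝ) ≤ ε * N) := by
  by_cases hRH : RiemannHypothesis
  · exact Or.inl ⟨rh_iff_liDescent_densityZero.1 hRH,
      fun h ↦ not_rh_iff_liDescent_syndetic.2 h hRH⟩
  · exact Or.inr ⟨not_rh_iff_liDescent_syndetic.1 hRH,
      fun h ↦ hRH (rh_iff_liDescent_densityZero.2 h)⟩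

end Summit.RiemannHypothesis.RiemannHypothesis.Theorems.Splittings.LiDescentZeroPositiveLaw

end
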